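import Mathlib.Analysis.SpecialFunctions.Complex.LogDeriv
import Mathlib.Analysis.Calculus.Deriv.ZPow
import Literature.NumberTheory.LFunctions.ImPhaseCalculus
import Literature.NumberTheory.LFunctions.TransverseStationarySum
import HarnessLib

/-!
# The phase `F(z) = Im(w log z)/2π` of the Hecke-character sums over `ℤ[i]` on a sector piece:
# trapezoids, the derivative chain of `G = (w/2π) log(z ū)`, and the size of its derivatives

Topic `Literature/NumberTheory/LFunctions` (the two-dimensional van der Corput method for the Weyl-type bound of
the Hecke `L`-functions `L(s, λ^m)` of `ℚ(i)`; R. M. Kaufman 1979, E. C. Titchmarsh 1934).  Everything here is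
PROVED; the definitions are the trapezoid `VdC.trap`, the half-plane `VdC.halfPlane` and the explicit functions
`VdC.logPhase`, `VdC.logPhase₁ … logPhase₄`.

For a Hecke character sum `∑ λ^m(z) N(z)^{-it}` the summand is `e(F(z))` with `F = Im(w log z)/2π`,
`w = 4m - 2ti` (tree: `GaussLine.phase_add_intCast`).  On a sector around the direction `u` (`‖u‖ = 1`) we use the
branch `G(z) = (w/2π) log(z ū)`, holomorphic on the half-plane `Re(z ū) > 0`, with
`G' = w/(2πz)`, `G'' = -w/(2πz²)`, `G''' = w/(πz³)`, `G'''' = -3w/(πz⁴)` (`logPhase_holChain`), and we work on the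
TRAPEZOID `trap u ρ₁ ρ₂ τ = {ρ₁ ≤ Re(zū) ≤ ρ₂, |Im(zū)| ≤ τ Re(zū)}` — a compact convex set (so that chords of
lattice lines are intervals, as `TransverseStationarySum.lean` requires) on which `ρ₁ ≤ ‖z‖ ≤ (1 + τ) ρ₂`
(`norm_ge_of_mem_trap`, `norm_le_of_mem_trap`), whence the derivative sizes
`‖G''‖ ≤ ‖w‖/(2πρ₁²)`, `‖G'''‖ ≤ ‖w‖/(πρ₁³)`, `‖G''‖ ≥ ‖w‖/(2π(1+τ)²ρ₂²)` (`norm_logPhase₂_le`, …).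

## References

* R. M. Kaufman, Zap. Nauchn. Sem. LOMI 91 (1979), 40–51 (the Weyl-type estimate for `L(1/2+it, λ^m)` over
  `ℚ(i)` by two-dimensional exponential sums). [Kaufman1979]
* E. C. Titchmarsh, *The lattice-points in a circle*, Proc. LMS (2) 38 (1935), 96–115. [Titchmarsh1935Lattice]
-/

noncomputable section

open Set Complex Real

namespace Literature.NumberTheory.LFunctions
namespace VdC

/-! ### The half-plane and the trapezoid -/

/-- The open half-plane `{Re(z ū) > 0}` in the direction `u`. [folklore] -/
def halfPlane (u : ℂ) : Set ℂ := {z : ℂ | 0 < (z * (starRingEnd ℂ) u).re}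

/-- The trapezoid `{ρ₁ ≤ Re(zū) ≤ ρ₂, |Im(zū)| ≤ τ Re(zū)}` around the direction `u`. [folklore] -/
def trap (u : ℂ) (ρ₁ ρ₂ τ : ℝ) : Set ℂ :=
  {z : ℂ | ρ₁ ≤ (z * (starRingEnd ℂ) u).re ∧ (z * (starRingEnd ℂ) u).re ≤ ρ₂ ∧
    |(z * (starRingEnd ℂ) u).im| ≤ τ * (z * (starRingEnd ℂ) u).re}

section Geometry

variable {u : ℂ} {ρ₁ ρ₂ τ : ℝ}

/-- Membership in the trapezoid. [folklore] -/
theorem mem_trap {z : ℂ} : z ∈ trap u ρ₁ ρ₂ τ ↔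
    ρ₁ ≤ (z * (starRingEnd ℂ) u).re ∧ (z * (starRingEnd ℂ) u).re ≤ ρ₂ ∧
      |(z * (starRingEnd ℂ) u).im| ≤ τ * (z * (starRingEnd ℂ) u).re := Iff.rfl

/-- The trapezoid lies in the half-plane when `ρ₁ > 0`. [folklore] -/
theorem trap_subset_halfPlane (hρ₁ : 0 < ρ₁) : trap u ρ₁ ρ₂ τ ⊆ halfPlane u :=
  fun _ hz => hρ₁.trans_le hz.1

/-- The half-plane is open. [folklore] -/
theorem isOpen_halfPlane (u : ℂ) : IsOpen (halfPlane u) :=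
  isOpen_lt continuous_const (Complex.continuous_re.comp (continuous_id.mul continuous_const))

/-- The trapezoid is closed. [folklore] -/
theorem isClosed_trap (u : ℂ) (ρ₁ ρ₂ τ : ℝ) : IsClosed (trap u ρ₁ ρ₂ τ) := by
  have hc : Continuous fun z : ℂ => z * (starRingEnd ℂ) u := continuous_id.mul continuous_const
  have hre : Continuous fun z : ℂ => (z * (starRingEnd ℂ) u).re := Complex.continuous_re.comp hc
  have him : Continuous fun z : ℂ => |(z * (starRingEnd ℂ) u).im| := (Complex.continuous_im.comp hc).abs
  refine (isClosed_le continuous_const hre).inter ((isClosed_le hre continuous_const).inter ?_)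
  exact isClosed_le him (continuous_const.mul hre)

/-- Real and imaginary parts of `(a • x + b • y) ū`. [folklore] -/
theorem smul_add_smul_mul_conj (x y : ℂ) (a b : ℝ) :
    ((a • x + b • y) * (starRingEnd ℂ) u).re = a * (x * (starRingEnd ℂ) u).re + b * (y * (starRingEnd ℂ) u).re ∧
      ((a • x + b • y) * (starRingEnd ℂ) u).im = a * (x * (starRingEnd ℂ) u).im + b * (y * (starRingEnd ℂ) u).im := by
  have : (a • x + b • y) * (starRingEnd ℂ) u = (a : ℂ) * (x * (starRingEnd ℂ) u) + (b : ℂ) * (y * (starRingEnd ℂ) u) := by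
    simp only [Complex.real_smul]; ring
  rw [this]
  simp only [Complex.add_re, Complex.add_im, Complex.mul_re, Complex.mul_im, Complex.ofReal_re, Complex.ofReal_im]
  constructor <;> ring

/-- The trapezoid is convex (an intersection of four half-planes). [folklore] -/
theorem convex_trap (u : ℂ) (ρ₁ ρ₂ τ : ℝ) : Convex ℝ (trap u ρ₁ ρ₂ τ) := by
  intro x hx y hy a b ha hb hab
  obtain ⟨hx1, hx2, hx3⟩ := hx
  obtain ⟨hy1, hy2, hy3⟩ := hy
  obtain ⟨hre, him⟩ := smul_add_smul_mul_conj (u := u) x y a b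
  refine ⟨?_, ?_, ?_⟩
  · rw [hre]
    have h1 := mul_le_mul_of_nonneg_left hx1 ha
    have h2 := mul_le_mul_of_nonneg_left hy1 hb
    have h3 : a * ρ₁ + b * ρ₁ = ρ₁ := by rw [← add_mul, hab, one_mul]
    linarith
  · rw [hre]
    have h1 := mul_le_mul_of_nonneg_left hx2 ha
    have h2 := mul_le_mul_of_nonneg_left hy2 hb
    have h3 : a * ρ₂ + b * ρ₂ = ρ₂ := by rw [← add_mul, hab, one_mul]
    linarith
  · rw [hre, him]
    calc |a * (x * (starRingEnd ℂ) u).im + b * (y * (starRingEnd ℂ) u).im|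
        ≤ |a * (x * (starRingEnd ℂ) u).im| + |b * (y * (starRingEnd ℂ) u).im| := abs_add_le _ _
      _ = a * |(x * (starRingEnd ℂ) u).im| + b * |(y * (starRingEnd ℂ) u).im| := by
          rw [abs_mul, abs_mul, abs_of_nonneg ha, abs_of_nonneg hb]
      _ ≤ a * (τ * (x * (starRingEnd ℂ) u).re) + b * (τ * (y * (starRingEnd ℂ) u).re) :=
          add_le_add (mul_le_mul_of_nonneg_left hx3 ha) (mul_le_mul_of_nonneg_left hy3 hb)
      _ = τ * (a * (x * (starRingEnd ℂ) u).re + b * (y * (starRingEnd ℂ) u).re) := by ring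

/-- `‖z‖ = ‖z ū‖` for `‖u‖ = 1`. [folklore] -/
theorem norm_mul_conj_eq {z : ℂ} (hu : ‖u‖ = 1) : ‖z * (starRingEnd ℂ) u‖ = ‖z‖ := by
  rw [norm_mul, Complex.norm_conj, hu, mul_one]

/-- On the trapezoid `‖z‖ ≥ ρ₁`. [folklore] -/
theorem norm_ge_of_mem_trap (hu : ‖u‖ = 1) {z : ℂ} (hz : z ∈ trap u ρ₁ ρ₂ τ) : ρ₁ ≤ ‖z‖ := by
  rw [← norm_mul_conj_eq hu]
  exact hz.1.trans (Complex.re_le_norm _)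

/-- On the trapezoid `‖z‖ ≤ (1 + τ) ρ₂` (for `τ ≥ 0`). [folklore] -/
theorem norm_le_of_mem_trap (hu : ‖u‖ = 1) (hρ₁ : 0 < ρ₁) (hτ : 0 ≤ τ) {z : ℂ} (hz : z ∈ trap u ρ₁ ρ₂ τ) :
    ‖z‖ ≤ (1 + τ) * ρ₂ := by
  rw [← norm_mul_conj_eq hu]
  set q := z * (starRingEnd ℂ) u with hq
  obtain ⟨h1, h2, h3⟩ := hz
  have hre : 0 ≤ q.re := by change ρ₁ ≤ q.re at h1; linarith
  calc ‖q‖ ≤ |q.re| + |q.im| := Complex.norm_le_abs_re_add_abs_im q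
    _ ≤ q.re + τ * q.re := by rw [abs_of_nonneg hre]; linarith
    _ = (1 + τ) * q.re := by ring
    _ ≤ (1 + τ) * ρ₂ := mul_le_mul_of_nonneg_left h2 (by linarith)

/-- Points of the trapezoid are nonzero (`ρ₁ > 0`). [folklore] -/
theorem ne_zero_of_mem_trap (hu : ‖u‖ = 1) (hρ₁ : 0 < ρ₁) {z : ℂ} (hz : z ∈ trap u ρ₁ ρ₂ τ) : z ≠ 0 := by
  intro h
  have := norm_ge_of_mem_trap hu hz
  rw [h, norm_zero] at this
  linarith

/-- The trapezoid is bounded, hence compact. [folklore] -/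
theorem isCompact_trap (hu : ‖u‖ = 1) (hρ₁ : 0 < ρ₁) (hτ : 0 ≤ τ) (ρ₂ : ℝ) : IsCompact (trap u ρ₁ ρ₂ τ) := by
  refine Metric.isCompact_of_isClosed_isBounded (isClosed_trap u ρ₁ ρ₂ τ) ?_
  refine (Metric.isBounded_closedBall (x := (0 : ℂ)) (r := (1 + τ) * |ρ₂|)).subset fun z hz => ?_
  rw [Metric.mem_closedBall, dist_zero_right]
  refine (norm_le_of_mem_trap hu hρ₁ hτ hz).trans ?_
  exact mul_le_mul_of_nonneg_left (le_abs_self _) (by linarith)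

/-- `0` is not in the trapezoid (`ρ₁ > 0`), so its complement is nonempty. [folklore] -/
theorem compl_trap_nonempty (hρ₁ : 0 < ρ₁) : (trap u ρ₁ ρ₂ τ)ᶜ.Nonempty :=
  ⟨0, fun h => by have := h.1; simp at this; linarith⟩

/-- Points of the half-plane are nonzero and `z ū` lies in the slit plane. [folklore] -/
theorem mem_slitPlane_of_halfPlane {z : ℂ} (hz : z ∈ halfPlane u) : z * (starRingEnd ℂ) u ∈ Complex.slitPlane :=
  Or.inl hz

/-- Points of the half-plane are nonzero. [folklore] -/
theorem ne_zero_of_halfPlane {z : ℂ} (hz : z ∈ halfPlane u) : z ≠ 0 := by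
  rintro rfl; simp [halfPlane] at hz

/-- If the half-plane of `u` is nonempty then `ū ≠ 0`. [folklore] -/
theorem conj_ne_zero_of_halfPlane {z : ℂ} (hz : z ∈ halfPlane u) : (starRingEnd ℂ) u ≠ 0 := by
  rintro h; simp [halfPlane, h] at hz

end Geometry

/-! ### The logarithmic phase and its derivative chain -/

/-- `G(z) = (w/2π) log(z ū)`. [folklore] -/
def logPhase (w u : ℂ) (z : ℂ) : ℂ := w / (2 * π) * Complex.log (z * (starRingEnd ℂ) u)

/-- `G'(z) = w/(2πz)`. [folklore] -/
def logPhase₁ (w : ℂ) (z : ℂ) : ℂ := w / (2 * π) * z ^ (-1 : ℤ)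

/-- `G''(z) = -w/(2πz²)`. [folklore] -/
def logPhase₂ (w : ℂ) (z : ℂ) : ℂ := -(w / (2 * π)) * z ^ (-2 : ℤ)

/-- `G'''(z) = 2w/(2πz³)`. [folklore] -/
def logPhase₃ (w : ℂ) (z : ℂ) : ℂ := 2 * (w / (2 * π)) * z ^ (-3 : ℤ)

/-- `G''''(z) = -6w/(2πz⁴)`. [folklore] -/
def logPhase₄ (w : ℂ) (z : ℂ) : ℂ := -6 * (w / (2 * π)) * z ^ (-4 : ℤ)

/-- **The derivative chain** of `G = (w/2π) log(z ū)` on the half-plane `Re(zū) > 0`. [folklore] -/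
theorem logPhase_holChain (w u : ℂ) :
    HolChain (halfPlane u) (logPhase w u) (logPhase₁ w) (logPhase₂ w) (logPhase₃ w) (logPhase₄ w) := by
  refine ⟨fun z hz => ?_, fun z hz => ?_, fun z hz => ?_, fun z hz => ?_⟩
  · -- `(log(z ū))' = ū/(zū) = 1/z`
    have hz0 := ne_zero_of_halfPlane hz
    have hu0 := conj_ne_zero_of_halfPlane hz
    have hlog := (Complex.hasDerivAt_log (mem_slitPlane_of_halfPlane hz)).comp z
      ((hasDerivAt_id z).mul_const ((starRingEnd ℂ) u))
    have h := hlog.const_mul (w / (2 * π))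
    refine h.congr_deriv ?_
    rw [logPhase₁, zpow_neg_one]
    field_simp
  · have hz0 := ne_zero_of_halfPlane hz
    have h := (hasDerivAt_zpow (-1 : ℤ) z (Or.inl hz0)).const_mul (w / (2 * π))
    refine h.congr_deriv ?_
    rw [logPhase₂]; push_cast; ring_nf
  · have hz0 := ne_zero_of_halfPlane hz
    have h := (hasDerivAt_zpow (-2 : ℤ) z (Or.inl hz0)).const_mul (-(w / (2 * π)))
    refine h.congr_deriv ?_
    rw [logPhase₃]; push_cast; ring_nf
  · have hz0 := ne_zero_of_halfPlane hz
    have h := (hasDerivAt_zpow (-3 : ℤ) z (Or.inl hz0)).const_mul (2 * (w / (2 * π)))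
    refine h.congr_deriv ?_
    rw [logPhase₄]; push_cast; ring_nf

/-! ### Sizes of the derivatives on the trapezoid -/

/-- `‖w/(2π)‖ = ‖w‖/(2π)`. [folklore] -/
theorem norm_coef (w : ℂ) : ‖w / (2 * (π : ℂ))‖ = ‖w‖ / (2 * π) := by
  rw [norm_div, Complex.norm_mul, Complex.norm_two, Complex.norm_real, Real.norm_eq_abs, abs_of_pos Real.pi_pos]

section Sizes

variable {w u : ℂ} {ρ₁ ρ₂ τ : ℝ} (hu : ‖u‖ = 1) (hρ₁ : 0 < ρ₁)
include hu hρ₁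

/-- `‖z^{-k}‖ = ‖z‖^{-k} ≤ ρ₁^{-k}` on the trapezoid. [folklore] -/
theorem norm_zpow_neg_le {z : ℂ} (hz : z ∈ trap u ρ₁ ρ₂ τ) (k : ℕ) :
    ‖z ^ (-(k : ℤ))‖ ≤ (ρ₁ ^ k)⁻¹ := by
  have hzn := norm_ge_of_mem_trap hu hz
  rw [norm_zpow, zpow_neg, zpow_natCast]
  exact inv_anti₀ (pow_pos hρ₁ k) (pow_le_pow_left₀ hρ₁.le hzn k)

/-- `‖G'(z)‖ ≤ ‖w‖/(2π) · ρ₁⁻¹` on the trapezoid. [folklore] -/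
theorem norm_logPhase₁_le {z : ℂ} (hz : z ∈ trap u ρ₁ ρ₂ τ) : ‖logPhase₁ w z‖ ≤ ‖w‖ / (2 * π) * (ρ₁ ^ 1)⁻¹ := by
  rw [logPhase₁, norm_mul, norm_coef]
  exact mul_le_mul_of_nonneg_left (norm_zpow_neg_le hu hρ₁ hz 1) (by positivity)

/-- `‖G''(z)‖ ≤ ‖w‖/(2π) · ρ₁⁻²` on the trapezoid. [folklore] -/
theorem norm_logPhase₂_le {z : ℂ} (hz : z ∈ trap u ρ₁ ρ₂ τ) : ‖logPhase₂ w z‖ ≤ ‖w‖ / (2 * π) * (ρ₁ ^ 2)⁻¹ := by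
  rw [logPhase₂, norm_mul, norm_neg, norm_coef]
  exact mul_le_mul_of_nonneg_left (norm_zpow_neg_le hu hρ₁ hz 2) (by positivity)

/-- `‖G⁽³⁾(z)‖ ≤ 2‖w‖/(2π) · ρ₁⁻³` on the trapezoid. [folklore] -/
theorem norm_logPhase₃_le {z : ℂ} (hz : z ∈ trap u ρ₁ ρ₂ τ) : ‖logPhase₃ w z‖ ≤ 2 * (‖w‖ / (2 * π)) * (ρ₁ ^ 3)⁻¹ := by
  rw [logPhase₃, norm_mul, norm_mul, Complex.norm_two, norm_coef]
  exact mul_le_mul_of_nonneg_left (norm_zpow_neg_le hu hρ₁ hz 3) (by positivity)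

/-- `‖G⁽⁴⁾(z)‖ ≤ 6‖w‖/(2π) · ρ₁⁻⁴` on the trapezoid. [folklore] -/
theorem norm_logPhase₄_le {z : ℂ} (hz : z ∈ trap u ρ₁ ρ₂ τ) : ‖logPhase₄ w z‖ ≤ 6 * (‖w‖ / (2 * π)) * (ρ₁ ^ 4)⁻¹ := by
  have h6 : ‖(-6 : ℂ) * (w / (2 * π))‖ = 6 * (‖w‖ / (2 * π)) := by
    rw [norm_mul, norm_neg, norm_coef]; norm_num
  rw [logPhase₄, norm_mul, h6]
  exact mul_le_mul_of_nonneg_left (norm_zpow_neg_le hu hρ₁ hz 4) (by positivity)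

/-- The lower bound `‖G''(z)‖ ≥ ‖w‖/(2π) · ((1+τ)ρ₂)⁻²` on the trapezoid (`τ ≥ 0`). [folklore] -/
theorem norm_logPhase₂_ge (hτ : 0 ≤ τ) {z : ℂ} (hz : z ∈ trap u ρ₁ ρ₂ τ) :
    ‖w‖ / (2 * π) * (((1 + τ) * ρ₂) ^ 2)⁻¹ ≤ ‖logPhase₂ w z‖ := by
  have hzn := norm_ge_of_mem_trap hu hz
  have hz0 : 0 < ‖z‖ := hρ₁.trans_le hzn
  have hzR := norm_le_of_mem_trap hu hρ₁ hτ hz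
  have hpow : ‖z ^ (-2 : ℤ)‖ = (‖z‖ ^ 2)⁻¹ := by
    rw [norm_zpow, zpow_neg, zpow_ofNat]
  rw [logPhase₂, norm_mul, norm_neg, norm_coef, hpow]
  refine mul_le_mul_of_nonneg_left ?_ (by positivity)
  exact inv_anti₀ (pow_pos hz0 2) (pow_le_pow_left₀ hz0.le hzR 2)

end Sizes


/-! ### The phase `F = Im G` along lattice lines: derivative chain and the transverse hypotheses -/

/-- `q`-free form of the chain rule along a line: `a ↦ Im K(ad + ce)` has derivative `Im(K₁(ad + ce) d)`.
[folklore] -/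
theorem hasDerivAt_im_line' {K K₁ : ℂ → ℂ} {d e : ℂ} {c a : ℝ}
    (hK : HasDerivAt K (K₁ ((a : ℂ) * d + (c : ℂ) * e)) ((a : ℂ) * d + (c : ℂ) * e)) :
    HasDerivAt (fun a : ℝ => (K ((a : ℂ) * d + (c : ℂ) * e)).im) ((K₁ ((a : ℂ) * d + (c : ℂ) * e) * d).im) a := by
  have h := hasDerivAt_im_line (K := K) (K₁ := K₁) (d := d) (e := e) (c := c) (a := a) 1 hK
  simp only [mul_one] at h
  exact h

section LinePhase

variable {w u d e : ℂ} {ρ₁ ρ₂ τ : ℝ} (hu : ‖u‖ = 1) (hρ₁ : 0 < ρ₁)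
include hρ₁

/-- **The derivative chain of `a ↦ F(ad + ce)`, `F = Im G`, at a point of the trapezoid**:
`p' = Im(G₁ d)`, `p'' = Im(G₂ d²)`, `p''' = Im(G₃ d³)`, `p'''' = Im(G₄ d⁴)`. [folklore] -/
theorem line_chain {c a : ℝ} (ha : (a : ℂ) * d + (c : ℂ) * e ∈ trap u ρ₁ ρ₂ τ) :
    HasDerivAt (fun a : ℝ => (logPhase w u ((a : ℂ) * d + (c : ℂ) * e)).im)
        ((logPhase₁ w ((a : ℂ) * d + (c : ℂ) * e) * d).im) a ∧
      HasDerivAt (fun a : ℝ => (logPhase₁ w ((a : ℂ) * d + (c : ℂ) * e) * d).im)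
        ((logPhase₂ w ((a : ℂ) * d + (c : ℂ) * e) * d ^ 2).im) a ∧
      HasDerivAt (fun a : ℝ => (logPhase₂ w ((a : ℂ) * d + (c : ℂ) * e) * d ^ 2).im)
        ((logPhase₃ w ((a : ℂ) * d + (c : ℂ) * e) * d ^ 3).im) a ∧
      HasDerivAt (fun a : ℝ => (logPhase₃ w ((a : ℂ) * d + (c : ℂ) * e) * d ^ 3).im)
        ((logPhase₄ w ((a : ℂ) * d + (c : ℂ) * e) * d ^ 4).im) a := by
  have hU := trap_subset_halfPlane (u := u) (ρ₂ := ρ₂) (τ := τ) hρ₁ ha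
  have HC := logPhase_holChain w u
  refine ⟨hasDerivAt_im_line' (HC.d1 _ hU), ?_, ?_, ?_⟩
  · exact (hasDerivAt_im_line d (HC.d2 _ hU)).congr_deriv (by ring_nf)
  · exact (hasDerivAt_im_line (d ^ 2) (HC.d3 _ hU)).congr_deriv (by ring_nf)
  · exact (hasDerivAt_im_line (d ^ 3) (HC.d4 _ hU)).congr_deriv (by ring_nf)

include hu in
/-- Upper bounds for the second and third derivatives along a line and for the mixed derivative. [folklore] -/
theorem line_bounds {z : ℂ} (hz : z ∈ trap u ρ₁ ρ₂ τ) :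
    (logPhase₂ w z * d ^ 2).im ≤ ‖w‖ / (2 * π) * (ρ₁ ^ 2)⁻¹ * ‖d‖ ^ 2 ∧
      |(logPhase₃ w z * d ^ 3).im| ≤ 2 * (‖w‖ / (2 * π)) * (ρ₁ ^ 3)⁻¹ * ‖d‖ ^ 3 ∧
      |(logPhase₂ w z * d * e).im| ≤ ‖w‖ / (2 * π) * (ρ₁ ^ 2)⁻¹ * (‖d‖ * ‖e‖) := by
  have h2 := norm_logPhase₂_le (w := w) hu hρ₁ hz
  have h3 := norm_logPhase₃_le (w := w) hu hρ₁ hz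
  refine ⟨?_, ?_, ?_⟩
  · refine (le_abs_self _).trans ((abs_im_mul_le _ _).trans ?_)
    rw [norm_pow]
    exact mul_le_mul_of_nonneg_right h2 (by positivity)
  · refine (abs_im_mul_le _ _).trans ?_
    rw [norm_pow]
    exact mul_le_mul_of_nonneg_right h3 (by positivity)
  · calc |(logPhase₂ w z * d * e).im| ≤ ‖logPhase₂ w z * d‖ * ‖e‖ := abs_im_mul_le _ _
      _ = ‖logPhase₂ w z‖ * (‖d‖ * ‖e‖) := by rw [norm_mul]; ring
      _ ≤ _ := mul_le_mul_of_nonneg_right h2 (by positivity)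

/-- `p''' = Im(G₃ d³)` is continuous along a chord. [folklore] -/
theorem continuousOn_line3 (c : ℝ) {S : Set ℝ} (hS : ∀ a ∈ S, (a : ℂ) * d + (c : ℂ) * e ∈ trap u ρ₁ ρ₂ τ) :
    ContinuousOn (fun a : ℝ => (logPhase₃ w ((a : ℂ) * d + (c : ℂ) * e) * d ^ 3).im) S :=
  fun a ha => ((line_chain (w := w) hρ₁ (hS a ha)).2.2.2).continuousAt.continuousWithinAt

end LinePhase

/-! ### The transverse hypotheses for `F = Im G` on a trapezoid -/

/-- The coefficient `‖w‖/(2π) · ρ^{-k}` (size of `G^{(k)}` up to the factor `(k-1)!`). [folklore] -/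
def coefB (w : ℂ) (ρ : ℝ) (k : ℕ) : ℝ := ‖w‖ / (2 * π) * (ρ ^ k)⁻¹

/-- `coefB` is nonnegative for `ρ > 0`. [folklore] -/
theorem coefB_nonneg (w : ℂ) {ρ : ℝ} (hρ : 0 < ρ) (k : ℕ) : 0 ≤ coefB w ρ k := by
  unfold coefB; positivity

/-- `coefB` is positive for `w ≠ 0`, `ρ > 0`. [folklore] -/
theorem coefB_pos {w : ℂ} (hw : w ≠ 0) {ρ : ℝ} (hρ : 0 < ρ) (k : ℕ) : 0 < coefB w ρ k := by
  have := norm_pos_iff.2 hw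
  unfold coefB; positivity

/-- `coefB` is antitone in `ρ`: `coefB w ρ' k ≤ coefB w ρ k` for `0 < ρ ≤ ρ'`. [folklore] -/
theorem coefB_anti (w : ℂ) {ρ ρ' : ℝ} (hρ : 0 < ρ) (h : ρ ≤ ρ') (k : ℕ) : coefB w ρ' k ≤ coefB w ρ k := by
  unfold coefB
  refine mul_le_mul_of_nonneg_left (inv_anti₀ (pow_pos hρ k) (pow_le_pow_left₀ hρ.le h k)) (by positivity)

/-- **`TransverseHyp` for a harmonic phase `F = Im G` on a trapezoid** (generic in the holomorphic `G`).  Given a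
derivative chain `G, G₁, …, G₄` on a set `U ⊇ T = trap u ρ₁ ρ₂ τ`, the sizes `b₂ ≤ ‖G₂‖ ≤ B₂`, `‖G₃‖ ≤ B₃` on `T`,
the direction condition `r ≤ Im(G₂ d²)` on `T` (`0 < r ≤ B₂‖d‖²`), a weight `φ` (`|φ| ≤ G`, `Lφ`-Lipschitz on `T`,
vanishing within `δ₀` of `Tᶜ`) and the smallness conditions, the data `F = Im G`, `F_d = Im(G₁d)`, …,
`F_ee = Im(G₂e²)` satisfy `VdC.TransverseHyp` with `A = B₂‖d‖²/r`, `Λ₂ = B₂m²`, `Λ₃ = B₃m³`,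
`κ₁ = b₂² Im(dē)²/(B₂‖d‖²)`, `κ₂ = B₂² Im(dē)²/r`, `L₂ = B₃‖d‖²` (`m = max(‖d‖,‖e‖)`). [folklore] -/
theorem transverseHyp_of_chain {U : Set ℂ} {G G₁ G₂ G₃ G₄ : ℂ → ℂ} {u d e : ℂ} {ρ₁ ρ₂ τ : ℝ}
    (HC : HolChain U G G₁ G₂ G₃ G₄) (hu : ‖u‖ = 1) (hρ₁ : 0 < ρ₁) (hτ : 0 ≤ τ) (hTU : trap u ρ₁ ρ₂ τ ⊆ U)
    (hd : d ≠ 0) (hde : (d * (starRingEnd ℂ) e).im ≠ 0)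
    {B₂ b₂ B₃ : ℝ} (hB₂0 : 0 < B₂) (hb₂0 : 0 < b₂) (hb₂B₂ : b₂ ≤ B₂) (hB₃0 : 0 ≤ B₃)
    (hG₂le : ∀ z ∈ trap u ρ₁ ρ₂ τ, ‖G₂ z‖ ≤ B₂) (hG₂ge : ∀ z ∈ trap u ρ₁ ρ₂ τ, b₂ ≤ ‖G₂ z‖)
    (hG₃le : ∀ z ∈ trap u ρ₁ ρ₂ τ, ‖G₃ z‖ ≤ B₃)
    {φ : ℂ → ℝ} {r Gw Lφ δ₀ : ℝ} (hr : 0 < r) (hG : 0 ≤ Gw) (hLφ : 0 ≤ Lφ)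
    (hdir : ∀ z ∈ trap u ρ₁ ρ₂ τ, r ≤ (G₂ z * d ^ 2).im)
    (hrB : r ≤ B₂ * ‖d‖ ^ 2)
    (hφG : ∀ z ∈ trap u ρ₁ ρ₂ τ, |φ z| ≤ Gw)
    (lipφ : ∀ z ∈ trap u ρ₁ ρ₂ τ, ∀ z' ∈ trap u ρ₁ ρ₂ τ, |φ z - φ z'| ≤ Lφ * ‖z - z'‖)
    (hφ0 : ∀ z, Metric.infDist z (trap u ρ₁ ρ₂ τ)ᶜ < δ₀ → φ z = 0)
    (hδ₀ : 2 * (‖e‖ + (B₂ * (max ‖d‖ ‖e‖) ^ 2 / r + 2) * ‖d‖ + 1) ≤ δ₀)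
    (hsmall1 : (B₃ * (max ‖d‖ ‖e‖) ^ 3) * (B₂ * (max ‖d‖ ‖e‖) ^ 2 / r + 1) ^ 2 ≤ r / 2)
    (hsmall2 : 4 * ((B₃ * (max ‖d‖ ‖e‖) ^ 3) * (B₂ * (max ‖d‖ ‖e‖) ^ 2 / r + 1) ^ 3
        + (B₃ * (max ‖d‖ ‖e‖) ^ 3) ^ 2 * (B₂ * (max ‖d‖ ‖e‖) ^ 2 / r + 1) ^ 4 / (2 * r))
      ≤ b₂ ^ 2 * (d * (starRingEnd ℂ) e).im ^ 2 / (B₂ * ‖d‖ ^ 2)) :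
    TransverseHyp (trap u ρ₁ ρ₂ τ) d e
      (fun z => (G z).im) (fun z => (G₁ z * d).im) (fun z => (G₁ z * e).im)
      (fun z => (G₂ z * d ^ 2).im) (fun z => (G₂ z * d * e).im) (fun z => (G₂ z * e ^ 2).im)
      φ r (B₂ * ‖d‖ ^ 2 / r) (B₂ * (max ‖d‖ ‖e‖) ^ 2) (B₃ * (max ‖d‖ ‖e‖) ^ 3)
      (b₂ ^ 2 * (d * (starRingEnd ℂ) e).im ^ 2 / (B₂ * ‖d‖ ^ 2)) (B₂ ^ 2 * (d * (starRingEnd ℂ) e).im ^ 2 / r)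
      (B₃ * ‖d‖ ^ 2) Gw Lφ δ₀ := by
  set T := trap u ρ₁ ρ₂ τ with hT
  set m : ℝ := max ‖d‖ ‖e‖ with hm
  set q : ℝ := (d * (starRingEnd ℂ) e).im with hq
  have hd0 : 0 < ‖d‖ := norm_pos_iff.2 hd
  have hq0 : 0 < q ^ 2 := by positivity
  have hm0 : 0 ≤ m := (norm_nonneg d).trans (le_max_left _ _)
  have hdm : ‖d‖ ≤ m := le_max_left _ _
  have hem : ‖e‖ ≤ m := le_max_right _ _
  have hconv : Convex ℝ T := convex_trap u ρ₁ ρ₂ τ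
  have hFdd_le : ∀ z ∈ T, (G₂ z * d ^ 2).im ≤ B₂ * ‖d‖ ^ 2 := fun z hz => by
    refine (le_abs_self _).trans ((abs_im_mul_le _ _).trans ?_)
    rw [norm_pow]
    exact mul_le_mul_of_nonneg_right (hG₂le z hz) (by positivity)
  refine
    { convex := hconv
      compact := isCompact_trap hu hρ₁ hτ ρ₂
      nonuniv := compl_trap_nonempty hρ₁
      d_ne := hd
      hr := hr
      hA := by rwa [le_div_iff₀ hr, one_mul]
      hΛ₂ := by positivity
      hΛ₃ := by positivity
      hκ₁ := by positivity
      hκ₁₂ := ?_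
      hL₂ := by positivity
      hG := hG
      hLφ := hLφ
      line1 := fun c a ha => hasDerivAt_im_line' (HC.d1 _ (hTU ha))
      line2 := fun c a ha => (hasDerivAt_im_line d (HC.d2 _ (hTU ha))).congr_deriv (by ring_nf)
      hFdd := fun z hz => ⟨hdir z hz, ?_⟩
      hFde := fun z hz => ?_
      hκ := fun z hz => ?_
      lipFdd := fun z hz z' hz' => ?_
      taylorF := fun z hz s σ hs hσ hzv => ?_
      taylorFd := fun z hz s σ hs hσ hzv => ?_
      hφG := hφG
      lipφ := lipφ
      hφ0 := hφ0
      hδ₀ := hδ₀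
      hsmall1 := hsmall1
      hsmall2 := hsmall2 }
  · -- `κ₁ ≤ κ₂`
    have h1 : b₂ ^ 2 * q ^ 2 ≤ B₂ ^ 2 * q ^ 2 := by
      have := pow_le_pow_left₀ hb₂0.le hb₂B₂ 2; nlinarith
    have h2 : B₂ ^ 2 * q ^ 2 / (B₂ * ‖d‖ ^ 2) ≤ B₂ ^ 2 * q ^ 2 / r :=
      div_le_div_of_nonneg_left (by positivity) hr hrB
    exact (div_le_div_of_nonneg_right h1 (by positivity)).trans h2
  · -- `F_dd ≤ A r`
    rw [div_mul_cancel₀ _ hr.ne']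
    exact hFdd_le z hz
  · -- `|F_de| ≤ Λ₂`
    calc |(G₂ z * d * e).im| ≤ ‖G₂ z * d‖ * ‖e‖ := abs_im_mul_le _ _
      _ = ‖G₂ z‖ * (‖d‖ * ‖e‖) := by rw [norm_mul]; ring
      _ ≤ B₂ * (‖d‖ * ‖e‖) := mul_le_mul_of_nonneg_right (hG₂le z hz) (by positivity)
      _ ≤ B₂ * m ^ 2 := by
          refine mul_le_mul_of_nonneg_left ?_ hB₂0.le
          rw [sq]; exact mul_le_mul hdm hem (norm_nonneg _) hm0
  · -- the Hessian bounds
    have hid := hessian_identity (G₂ z) d e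
    have hFdd0 : 0 < (G₂ z * d ^ 2).im := hr.trans_le (hdir z hz)
    change b₂ ^ 2 * q ^ 2 / (B₂ * ‖d‖ ^ 2) ≤ _ ∧ _ ≤ B₂ ^ 2 * q ^ 2 / r
    rw [hid]
    have hnum_lo : b₂ ^ 2 * q ^ 2 ≤ ‖G₂ z‖ ^ 2 * q ^ 2 := by
      have := pow_le_pow_left₀ hb₂0.le (hG₂ge z hz) 2; nlinarith
    have hnum_hi : ‖G₂ z‖ ^ 2 * q ^ 2 ≤ B₂ ^ 2 * q ^ 2 := by
      have := pow_le_pow_left₀ (norm_nonneg _) (hG₂le z hz) 2; nlinarith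
    constructor
    · calc b₂ ^ 2 * q ^ 2 / (B₂ * ‖d‖ ^ 2) ≤ b₂ ^ 2 * q ^ 2 / (G₂ z * d ^ 2).im :=
            div_le_div_of_nonneg_left (by positivity) hFdd0 (hFdd_le z hz)
        _ ≤ ‖G₂ z‖ ^ 2 * q ^ 2 / (G₂ z * d ^ 2).im := div_le_div_of_nonneg_right hnum_lo hFdd0.le
    · calc ‖G₂ z‖ ^ 2 * q ^ 2 / (G₂ z * d ^ 2).im
          ≤ ‖G₂ z‖ ^ 2 * q ^ 2 / r := div_le_div_of_nonneg_left (by positivity) hr (hdir z hz)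
        _ ≤ B₂ ^ 2 * q ^ 2 / r := div_le_div_of_nonneg_right hnum_hi hr.le
  · exact abs_Fdd_sub_le HC hconv hTU hG₃le d hz hz'
  · have h := abs_taylorF_le HC hconv hTU hG₃le d e hz hzv
    refine h.trans ?_
    have hv := norm_step_le_max (d := d) (e := e) (s := s) hσ
    calc B₃ * ‖(s : ℂ) * d + (σ : ℂ) * e‖ ^ 3 ≤ B₃ * ((|s| + 1) * m) ^ 3 :=
          mul_le_mul_of_nonneg_left (pow_le_pow_left₀ (norm_nonneg _) hv 3) hB₃0
      _ = B₃ * m ^ 3 * (|s| + 1) ^ 3 := by ring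
  · have h := abs_taylorFd_le HC hconv hTU hG₃le d e hz hzv
    refine h.trans ?_
    have hv := norm_step_le_max (d := d) (e := e) (s := s) hσ
    calc B₃ * ‖d‖ * ‖(s : ℂ) * d + (σ : ℂ) * e‖ ^ 2 ≤ B₃ * m * ((|s| + 1) * m) ^ 2 := by
          refine mul_le_mul (mul_le_mul_of_nonneg_left hdm hB₃0) (pow_le_pow_left₀ (norm_nonneg _) hv 2)
            (by positivity) (by positivity)
      _ = B₃ * m ^ 3 * (|s| + 1) ^ 2 := by ring

/-- **`TransverseHyp` for the logarithmic phase `G = (w/2π) log(zū)` on a trapezoid** (specialisation of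
`transverseHyp_of_chain` with `B₂ = coefB w ρ₁ 2`, `b₂ = coefB w ((1+τ)ρ₂) 2`, `B₃ = 2 coefB w ρ₁ 3`). [folklore] -/
theorem transverseHyp_logPhase {w u d e : ℂ} {ρ₁ ρ₂ τ : ℝ} (hu : ‖u‖ = 1) (hρ₁ : 0 < ρ₁) (hρ₁₂ : ρ₁ ≤ ρ₂)
    (hτ : 0 ≤ τ) (hw : w ≠ 0) (hd : d ≠ 0) (hde : (d * (starRingEnd ℂ) e).im ≠ 0)
    {φ : ℂ → ℝ} {r G Lφ δ₀ : ℝ} (hr : 0 < r) (hG : 0 ≤ G) (hLφ : 0 ≤ Lφ)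
    (hdir : ∀ z ∈ trap u ρ₁ ρ₂ τ, r ≤ (logPhase₂ w z * d ^ 2).im)
    (hrB : r ≤ coefB w ρ₁ 2 * ‖d‖ ^ 2)
    (hφG : ∀ z ∈ trap u ρ₁ ρ₂ τ, |φ z| ≤ G)
    (lipφ : ∀ z ∈ trap u ρ₁ ρ₂ τ, ∀ z' ∈ trap u ρ₁ ρ₂ τ, |φ z - φ z'| ≤ Lφ * ‖z - z'‖)
    (hφ0 : ∀ z, Metric.infDist z (trap u ρ₁ ρ₂ τ)ᶜ < δ₀ → φ z = 0)
    (hδ₀ : 2 * (‖e‖ + (coefB w ρ₁ 2 * (max ‖d‖ ‖e‖) ^ 2 / r + 2) * ‖d‖ + 1) ≤ δ₀)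
    (hsmall1 : (2 * coefB w ρ₁ 3 * (max ‖d‖ ‖e‖) ^ 3) * (coefB w ρ₁ 2 * (max ‖d‖ ‖e‖) ^ 2 / r + 1) ^ 2 ≤ r / 2)
    (hsmall2 : 4 * ((2 * coefB w ρ₁ 3 * (max ‖d‖ ‖e‖) ^ 3) * (coefB w ρ₁ 2 * (max ‖d‖ ‖e‖) ^ 2 / r + 1) ^ 3
        + (2 * coefB w ρ₁ 3 * (max ‖d‖ ‖e‖) ^ 3) ^ 2 * (coefB w ρ₁ 2 * (max ‖d‖ ‖e‖) ^ 2 / r + 1) ^ 4 / (2 * r))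
      ≤ coefB w ((1 + τ) * ρ₂) 2 ^ 2 * (d * (starRingEnd ℂ) e).im ^ 2 / (coefB w ρ₁ 2 * ‖d‖ ^ 2)) :
    TransverseHyp (trap u ρ₁ ρ₂ τ) d e
      (fun z => (logPhase w u z).im) (fun z => (logPhase₁ w z * d).im) (fun z => (logPhase₁ w z * e).im)
      (fun z => (logPhase₂ w z * d ^ 2).im) (fun z => (logPhase₂ w z * d * e).im) (fun z => (logPhase₂ w z * e ^ 2).im)
      φ r (coefB w ρ₁ 2 * ‖d‖ ^ 2 / r) (coefB w ρ₁ 2 * (max ‖d‖ ‖e‖) ^ 2) (2 * coefB w ρ₁ 3 * (max ‖d‖ ‖e‖) ^ 3)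
      (coefB w ((1 + τ) * ρ₂) 2 ^ 2 * (d * (starRingEnd ℂ) e).im ^ 2 / (coefB w ρ₁ 2 * ‖d‖ ^ 2))
      (coefB w ρ₁ 2 ^ 2 * (d * (starRingEnd ℂ) e).im ^ 2 / r)
      (2 * coefB w ρ₁ 3 * ‖d‖ ^ 2) G Lφ δ₀ := by
  have hρ₂ : 0 < ρ₂ := hρ₁.trans_le hρ₁₂
  have hρ₂' : 0 < (1 + τ) * ρ₂ := by positivity
  have hb₂B₂ : coefB w ((1 + τ) * ρ₂) 2 ≤ coefB w ρ₁ 2 := coefB_anti w hρ₁ (by nlinarith) 2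
  have hB₃' : ∀ z ∈ trap u ρ₁ ρ₂ τ, ‖logPhase₃ w z‖ ≤ 2 * coefB w ρ₁ 3 := fun z hz => by
    have := norm_logPhase₃_le (w := w) hu hρ₁ hz; unfold coefB; linarith
  exact transverseHyp_of_chain (logPhase_holChain w u) hu hρ₁ hτ (trap_subset_halfPlane hρ₁) hd hde
    (coefB_pos hw hρ₁ 2) (coefB_pos hw hρ₂' 2) hb₂B₂ (by have := coefB_nonneg w hρ₁ 3; positivity)
    (fun z hz => norm_logPhase₂_le hu hρ₁ hz) (fun z hz => norm_logPhase₂_ge hu hρ₁ hτ hz) hB₃'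
    hr hG hLφ hdir hrB hφG lipφ hφ0 hδ₀ hsmall1 hsmall2


/-! ### The differenced phase `G_h(z) = G(z+h) - G(z)` -/

/-- `G_h(z) = G(z+h) - G(z)`. [folklore] -/
def shiftPhase (w u h : ℂ) (z : ℂ) : ℂ := logPhase w u (z + h) - logPhase w u z

/-- `G_h'`. [folklore] -/
def shiftPhase₁ (w h : ℂ) (z : ℂ) : ℂ := logPhase₁ w (z + h) - logPhase₁ w z

/-- `G_h''`. [folklore] -/
def shiftPhase₂ (w h : ℂ) (z : ℂ) : ℂ := logPhase₂ w (z + h) - logPhase₂ w z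

/-- `G_h'''`. [folklore] -/
def shiftPhase₃ (w h : ℂ) (z : ℂ) : ℂ := logPhase₃ w (z + h) - logPhase₃ w z

/-- `G_h''''`. [folklore] -/
def shiftPhase₄ (w h : ℂ) (z : ℂ) : ℂ := logPhase₄ w (z + h) - logPhase₄ w z

/-- The domain of `G_h`: both `z` and `z + h` in the half-plane. [folklore] -/
def shiftDom (u h : ℂ) : Set ℂ := {z : ℂ | z ∈ halfPlane u ∧ z + h ∈ halfPlane u}

/-- The derivative chain of `G_h`. [folklore] -/
theorem shiftPhase_holChain (w u h : ℂ) :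
    HolChain (shiftDom u h) (shiftPhase w u h) (shiftPhase₁ w h) (shiftPhase₂ w h) (shiftPhase₃ w h)
      (shiftPhase₄ w h) := by
  have HC := logPhase_holChain w u
  refine ⟨fun z hz => ?_, fun z hz => ?_, fun z hz => ?_, fun z hz => ?_⟩
  · exact (HasDerivAt.comp_add_const z h (HC.d1 _ hz.2)).sub (HC.d1 _ hz.1)
  · exact (HasDerivAt.comp_add_const z h (HC.d2 _ hz.2)).sub (HC.d2 _ hz.1)
  · exact (HasDerivAt.comp_add_const z h (HC.d3 _ hz.2)).sub (HC.d3 _ hz.1)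
  · exact (HasDerivAt.comp_add_const z h (HC.d4 _ hz.2)).sub (HC.d4 _ hz.1)

section Shift

variable {w u h : ℂ} {ρ₁ ρ₂ τ : ℝ} (hu : ‖u‖ = 1) (hρ₁ : 0 < ρ₁)
include hu hρ₁

/-- For `‖h‖ < ρ₁` the trapezoid lies in the domain of `G_h`. [folklore] -/
theorem trap_subset_shiftDom (hh : ‖h‖ < ρ₁) : trap u ρ₁ ρ₂ τ ⊆ shiftDom u h := by
  intro z hz
  refine ⟨trap_subset_halfPlane hρ₁ hz, ?_⟩
  change 0 < ((z + h) * (starRingEnd ℂ) u).re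
  have h1 : ρ₁ ≤ (z * (starRingEnd ℂ) u).re := hz.1
  have h2 : |(h * (starRingEnd ℂ) u).re| ≤ ‖h‖ := by
    refine (Complex.abs_re_le_norm _).trans ?_
    rw [norm_mul_conj_eq hu]
  rw [add_mul, Complex.add_re]
  have := neg_abs_le (h * (starRingEnd ℂ) u).re
  linarith

omit hu hρ₁ in
/-- Algebra: `z'⁻² − z⁻² = (z − z') z⁻¹ z'⁻¹ (z⁻¹ + z'⁻¹)`. [folklore] -/
theorem zpow_neg_two_sub {z z' : ℂ} (hz : z ≠ 0) (hz' : z' ≠ 0) :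
    z' ^ (-2 : ℤ) - z ^ (-2 : ℤ) = (z - z') * (z⁻¹ * z'⁻¹) * (z⁻¹ + z'⁻¹) := by
  rw [zpow_neg, zpow_neg, zpow_ofNat, zpow_ofNat]
  field_simp
  ring

omit hu hρ₁ in
/-- Algebra: `z'⁻³ − z⁻³ = (z − z') z⁻¹ z'⁻¹ (z⁻² + z⁻¹z'⁻¹ + z'⁻²)`. [folklore] -/
theorem zpow_neg_three_sub {z z' : ℂ} (hz : z ≠ 0) (hz' : z' ≠ 0) :
    z' ^ (-3 : ℤ) - z ^ (-3 : ℤ) = (z - z') * (z⁻¹ * z'⁻¹) * (z⁻¹ ^ 2 + z⁻¹ * z'⁻¹ + z'⁻¹ ^ 2) := by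
  rw [zpow_neg, zpow_neg, zpow_ofNat, zpow_ofNat]
  field_simp
  ring

omit hu hρ₁ in
/-- Algebra: `z'⁻¹ − z⁻¹ = (z − z') z⁻¹ z'⁻¹`. [folklore] -/
theorem inv_sub_inv' {z z' : ℂ} (hz : z ≠ 0) (hz' : z' ≠ 0) :
    z'⁻¹ - z⁻¹ = (z - z') * (z⁻¹ * z'⁻¹) := by
  field_simp

omit hu hρ₁ in
/-- Norms of `z⁻¹`, `(z+h)⁻¹` when `‖h‖ ≤ ‖z‖/100`: with `α = ‖z‖⁻¹`,
`(100/101) α ≤ ‖(z+h)⁻¹‖ ≤ (100/99) α`. [folklore] -/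
theorem norm_inv_add_bounds {z h : ℂ} (hz : z ≠ 0) (hh : ‖h‖ ≤ ‖z‖ / 100) :
    z + h ≠ 0 ∧ ‖(z + h)⁻¹‖ ≤ 100 / 99 * ‖z‖⁻¹ ∧ 100 / 101 * ‖z‖⁻¹ ≤ ‖(z + h)⁻¹‖ := by
  have hz0 : 0 < ‖z‖ := norm_pos_iff.2 hz
  have hlo : 99 / 100 * ‖z‖ ≤ ‖z + h‖ := by
    have := norm_sub_norm_le z (z + h)
    rw [sub_add_cancel_left, norm_neg] at this
    linarith
  have hhi : ‖z + h‖ ≤ 101 / 100 * ‖z‖ := (norm_add_le _ _).trans (by linarith)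
  have hpos : 0 < ‖z + h‖ := lt_of_lt_of_le (by positivity) hlo
  refine ⟨norm_pos_iff.1 hpos, ?_, ?_⟩
  · rw [norm_inv]
    calc ‖z + h‖⁻¹ ≤ (99 / 100 * ‖z‖)⁻¹ := inv_anti₀ (by positivity) hlo
      _ = 100 / 99 * ‖z‖⁻¹ := by rw [mul_inv]; norm_num
  · rw [norm_inv]
    calc 100 / 101 * ‖z‖⁻¹ = (101 / 100 * ‖z‖)⁻¹ := by rw [mul_inv]; norm_num
      _ ≤ ‖z + h‖⁻¹ := inv_anti₀ hpos hhi

/-- **Upper bound for `G_h''`** on the trapezoid: `‖G_h''(z)‖ ≤ 3 ‖h‖ · coefB w ρ₁ 3` for `‖h‖ ≤ ρ₁/100`.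
[folklore] -/
theorem norm_shiftPhase₂_le (hh : ‖h‖ ≤ ρ₁ / 100) {z : ℂ} (hz : z ∈ trap u ρ₁ ρ₂ τ) :
    ‖shiftPhase₂ w h z‖ ≤ 3 * ‖h‖ * coefB w ρ₁ 3 := by
  have hzn := norm_ge_of_mem_trap hu hz
  have hz0 : z ≠ 0 := ne_zero_of_mem_trap hu hρ₁ hz
  have hzp : 0 < ‖z‖ := norm_pos_iff.2 hz0
  have hh' : ‖h‖ ≤ ‖z‖ / 100 := hh.trans (by linarith)
  obtain ⟨hz'0, hβle, -⟩ := norm_inv_add_bounds hz0 hh'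
  set α : ℝ := ‖z‖⁻¹ with hα
  have hα0 : 0 < α := by positivity
  have hid : shiftPhase₂ w h z = -(w / (2 * π)) * ((z + h) ^ (-2 : ℤ) - z ^ (-2 : ℤ)) := by
    simp only [shiftPhase₂, logPhase₂]; ring
  rw [hid, zpow_neg_two_sub hz0 hz'0, norm_mul, norm_neg, norm_coef]
  have hzz : z - (z + h) = -h := by ring
  rw [hzz]
  have hprod : ‖-h * (z⁻¹ * (z + h)⁻¹) * (z⁻¹ + (z + h)⁻¹)‖ ≤ ‖h‖ * (α * (100 / 99 * α)) * (α + 100 / 99 * α) := by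
    rw [norm_mul, norm_mul, norm_neg, norm_mul]
    have h1 : ‖z⁻¹‖ = α := by rw [norm_inv]
    rw [h1]
    have h2 : ‖z⁻¹ + (z + h)⁻¹‖ ≤ α + 100 / 99 * α := (norm_add_le _ _).trans (by rw [h1]; linarith)
    gcongr
  have hα1 : α ≤ ρ₁⁻¹ := inv_anti₀ hρ₁ hzn
  have hα3 : α ^ 3 ≤ (ρ₁ ^ 3)⁻¹ := by rw [← inv_pow]; exact pow_le_pow_left₀ hα0.le hα1 3
  have hw0 : 0 ≤ ‖w‖ / (2 * π) := by positivity
  calc ‖w‖ / (2 * π) * ‖-h * (z⁻¹ * (z + h)⁻¹) * (z⁻¹ + (z + h)⁻¹)‖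
      ≤ ‖w‖ / (2 * π) * (‖h‖ * (α * (100 / 99 * α)) * (α + 100 / 99 * α)) :=
        mul_le_mul_of_nonneg_left hprod hw0
    _ = ‖w‖ / (2 * π) * ‖h‖ * α ^ 3 * (19900 / 9801) := by ring
    _ ≤ ‖w‖ / (2 * π) * ‖h‖ * (ρ₁ ^ 3)⁻¹ * 3 := by
        refine mul_le_mul (mul_le_mul_of_nonneg_left hα3 (by positivity)) (by norm_num) (by norm_num)
          (by positivity)
    _ = 3 * ‖h‖ * coefB w ρ₁ 3 := by unfold coefB; ring

/-- **Upper bound for `G_h'''`** on the trapezoid: `‖G_h'''(z)‖ ≤ 8 ‖h‖ · coefB w ρ₁ 4` for `‖h‖ ≤ ρ₁/100`.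
[folklore] -/
theorem norm_shiftPhase₃_le (hh : ‖h‖ ≤ ρ₁ / 100) {z : ℂ} (hz : z ∈ trap u ρ₁ ρ₂ τ) :
    ‖shiftPhase₃ w h z‖ ≤ 8 * ‖h‖ * coefB w ρ₁ 4 := by
  have hzn := norm_ge_of_mem_trap hu hz
  have hz0 : z ≠ 0 := ne_zero_of_mem_trap hu hρ₁ hz
  have hzp : 0 < ‖z‖ := norm_pos_iff.2 hz0
  have hh' : ‖h‖ ≤ ‖z‖ / 100 := hh.trans (by linarith)
  obtain ⟨hz'0, hβle, -⟩ := norm_inv_add_bounds hz0 hh'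
  set α : ℝ := ‖z‖⁻¹ with hα
  have hα0 : 0 < α := by positivity
  have hid : shiftPhase₃ w h z = 2 * (w / (2 * π)) * ((z + h) ^ (-3 : ℤ) - z ^ (-3 : ℤ)) := by
    simp only [shiftPhase₃, logPhase₃]; ring
  rw [hid, zpow_neg_three_sub hz0 hz'0, norm_mul, norm_mul, Complex.norm_two, norm_coef]
  have hzz : z - (z + h) = -h := by ring
  rw [hzz]
  have h1 : ‖z⁻¹‖ = α := by rw [norm_inv]
  have hprod : ‖-h * (z⁻¹ * (z + h)⁻¹) * (z⁻¹ ^ 2 + z⁻¹ * (z + h)⁻¹ + (z + h)⁻¹ ^ 2)‖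
      ≤ ‖h‖ * (α * (100 / 99 * α)) * (α ^ 2 + α * (100 / 99 * α) + (100 / 99 * α) ^ 2) := by
    rw [norm_mul, norm_mul, norm_neg, norm_mul, h1]
    have h2 : ‖z⁻¹ ^ 2 + z⁻¹ * (z + h)⁻¹ + (z + h)⁻¹ ^ 2‖
        ≤ α ^ 2 + α * (100 / 99 * α) + (100 / 99 * α) ^ 2 := by
      refine (norm_add_le _ _).trans (add_le_add ((norm_add_le _ _).trans (add_le_add ?_ ?_)) ?_)
      · rw [norm_pow, h1]
      · rw [norm_mul, h1]; gcongr
      · rw [norm_pow]; gcongr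
    gcongr
  have hα1 : α ≤ ρ₁⁻¹ := inv_anti₀ hρ₁ hzn
  have hα4 : α ^ 4 ≤ (ρ₁ ^ 4)⁻¹ := by rw [← inv_pow]; exact pow_le_pow_left₀ hα0.le hα1 4
  have hw0 : 0 ≤ ‖w‖ / (2 * π) := by positivity
  calc 2 * (‖w‖ / (2 * π)) * ‖-h * (z⁻¹ * (z + h)⁻¹) * (z⁻¹ ^ 2 + z⁻¹ * (z + h)⁻¹ + (z + h)⁻¹ ^ 2)‖
      ≤ 2 * (‖w‖ / (2 * π)) * (‖h‖ * (α * (100 / 99 * α)) * (α ^ 2 + α * (100 / 99 * α) + (100 / 99 * α) ^ 2)) :=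
        mul_le_mul_of_nonneg_left hprod (by positivity)
    _ = ‖w‖ / (2 * π) * ‖h‖ * α ^ 4 * (2 * (100 / 99) * (1 + 100 / 99 + (100 / 99) ^ 2)) := by ring
    _ ≤ ‖w‖ / (2 * π) * ‖h‖ * (ρ₁ ^ 4)⁻¹ * 8 := by
        refine mul_le_mul (mul_le_mul_of_nonneg_left hα4 (by positivity)) (by norm_num) (by norm_num)
          (by positivity)
    _ = 8 * ‖h‖ * coefB w ρ₁ 4 := by unfold coefB; ring

/-- **Lower bound for `G_h''`** on the trapezoid: `‖G_h''(z)‖ ≥ ‖h‖ · coefB w ((1+τ)ρ₂) 3` for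
`‖h‖ ≤ ρ₁/100`, `τ ≥ 0`. [folklore] -/
theorem norm_shiftPhase₂_ge (hτ : 0 ≤ τ) (hh : ‖h‖ ≤ ρ₁ / 100) {z : ℂ} (hz : z ∈ trap u ρ₁ ρ₂ τ) :
    ‖h‖ * coefB w ((1 + τ) * ρ₂) 3 ≤ ‖shiftPhase₂ w h z‖ := by
  have hzn := norm_ge_of_mem_trap hu hz
  have hzR := norm_le_of_mem_trap hu hρ₁ hτ hz
  have hz0 : z ≠ 0 := ne_zero_of_mem_trap hu hρ₁ hz
  have hzp : 0 < ‖z‖ := norm_pos_iff.2 hz0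
  have hR : 0 < (1 + τ) * ρ₂ := hzp.trans_le hzR
  have hh' : ‖h‖ ≤ ‖z‖ / 100 := hh.trans (by linarith)
  obtain ⟨hz'0, hβle, hβge⟩ := norm_inv_add_bounds hz0 hh'
  set α : ℝ := ‖z‖⁻¹ with hα
  have hα0 : 0 < α := by positivity
  have h1 : ‖z⁻¹‖ = α := by rw [norm_inv]
  have hid : shiftPhase₂ w h z = -(w / (2 * π)) * ((z + h) ^ (-2 : ℤ) - z ^ (-2 : ℤ)) := by
    simp only [shiftPhase₂, logPhase₂]; ring
  rw [hid, zpow_neg_two_sub hz0 hz'0, norm_mul, norm_neg, norm_coef]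
  have hzz : z - (z + h) = -h := by ring
  rw [hzz]
  -- `‖z⁻¹ + (z+h)⁻¹‖ ≥ 2α − ‖(z+h)⁻¹ − z⁻¹‖ ≥ 2α − α/99`
  have hdiff : ‖(z + h)⁻¹ - z⁻¹‖ ≤ α / 99 := by
    rw [inv_sub_inv' hz0 hz'0, hzz, norm_mul, norm_neg, norm_mul, h1]
    calc ‖h‖ * (α * ‖(z + h)⁻¹‖) ≤ ‖z‖ / 100 * (α * (100 / 99 * α)) := by gcongr
      _ = (‖z‖ * α) * α / 99 := by ring
      _ = α / 99 := by rw [hα, mul_inv_cancel₀ hzp.ne']; ring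
  have hsum : 197 / 99 * α ≤ ‖z⁻¹ + (z + h)⁻¹‖ := by
    have h2 : ‖(2 : ℂ) * z⁻¹‖ = 2 * α := by rw [norm_mul, Complex.norm_two, h1]
    have h3 : (2 : ℂ) * z⁻¹ = (z⁻¹ + (z + h)⁻¹) - ((z + h)⁻¹ - z⁻¹) := by ring
    have h4 : ‖(2 : ℂ) * z⁻¹‖ ≤ ‖z⁻¹ + (z + h)⁻¹‖ + ‖(z + h)⁻¹ - z⁻¹‖ := by
      rw [h3]; exact norm_sub_le _ _
    linarith
  have hprod : ‖h‖ * (α * (100 / 101 * α)) * (197 / 99 * α)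
      ≤ ‖-h * (z⁻¹ * (z + h)⁻¹) * (z⁻¹ + (z + h)⁻¹)‖ := by
    rw [norm_mul, norm_mul, norm_neg, norm_mul, h1]
    gcongr
  have hαR : ((1 + τ) * ρ₂)⁻¹ ≤ α := inv_anti₀ hzp hzR
  have hα3 : (((1 + τ) * ρ₂) ^ 3)⁻¹ ≤ α ^ 3 := by
    rw [← inv_pow]; exact pow_le_pow_left₀ (by positivity) hαR 3
  have hw0 : 0 ≤ ‖w‖ / (2 * π) := by positivity
  calc ‖h‖ * coefB w ((1 + τ) * ρ₂) 3 = ‖w‖ / (2 * π) * (‖h‖ * (((1 + τ) * ρ₂) ^ 3)⁻¹ * 1) := by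
        unfold coefB; ring
    _ ≤ ‖w‖ / (2 * π) * (‖h‖ * α ^ 3 * (100 / 101 * (197 / 99))) := by
        refine mul_le_mul_of_nonneg_left ?_ hw0
        exact mul_le_mul (mul_le_mul_of_nonneg_left hα3 (norm_nonneg _)) (by norm_num) (by norm_num)
          (by positivity)
    _ = ‖w‖ / (2 * π) * (‖h‖ * (α * (100 / 101 * α)) * (197 / 99 * α)) := by ring
    _ ≤ ‖w‖ / (2 * π) * ‖-h * (z⁻¹ * (z + h)⁻¹) * (z⁻¹ + (z + h)⁻¹)‖ :=
        mul_le_mul_of_nonneg_left hprod hw0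

end Shift

/-- `p''' = Im(G₃ d³)` is continuous along a chord, for any derivative chain. [folklore] -/
theorem HolChain.continuousOn_line3 {U : Set ℂ} {G G₁ G₂ G₃ G₄ : ℂ → ℂ} (HC : HolChain U G G₁ G₂ G₃ G₄)
    {d e : ℂ} (c : ℝ) {S : Set ℝ} (hS : ∀ a ∈ S, (a : ℂ) * d + (c : ℂ) * e ∈ U) :
    ContinuousOn (fun a : ℝ => (G₃ ((a : ℂ) * d + (c : ℂ) * e) * d ^ 3).im) S :=
  fun a ha => (hasDerivAt_im_line (d ^ 3) (HC.d4 _ (hS a ha))).continuousAt.continuousWithinAt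

/-- **`TransverseHyp` for the differenced phase `G_h`** on a trapezoid, `0 < ‖h‖ ≤ ρ₁/100`
(specialisation of `transverseHyp_of_chain` with `B₂ = 3‖h‖ coefB w ρ₁ 3`, `b₂ = ‖h‖ coefB w ((1+τ)ρ₂) 3`,
`B₃ = 8‖h‖ coefB w ρ₁ 4`). [folklore] -/
theorem transverseHyp_shiftPhase {w u h d e : ℂ} {ρ₁ ρ₂ τ : ℝ} (hu : ‖u‖ = 1) (hρ₁ : 0 < ρ₁) (hρ₁₂ : ρ₁ ≤ ρ₂)
    (hτ : 0 ≤ τ) (hw : w ≠ 0) (hh0 : h ≠ 0) (hh : ‖h‖ ≤ ρ₁ / 100) (hd : d ≠ 0)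
    (hde : (d * (starRingEnd ℂ) e).im ≠ 0)
    {φ : ℂ → ℝ} {r G Lφ δ₀ : ℝ} (hr : 0 < r) (hG : 0 ≤ G) (hLφ : 0 ≤ Lφ)
    (hdir : ∀ z ∈ trap u ρ₁ ρ₂ τ, r ≤ (shiftPhase₂ w h z * d ^ 2).im)
    (hrB : r ≤ 3 * ‖h‖ * coefB w ρ₁ 3 * ‖d‖ ^ 2)
    (hφG : ∀ z ∈ trap u ρ₁ ρ₂ τ, |φ z| ≤ G)
    (lipφ : ∀ z ∈ trap u ρ₁ ρ₂ τ, ∀ z' ∈ trap u ρ₁ ρ₂ τ, |φ z - φ z'| ≤ Lφ * ‖z - z'‖)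
    (hφ0 : ∀ z, Metric.infDist z (trap u ρ₁ ρ₂ τ)ᶜ < δ₀ → φ z = 0)
    (hδ₀ : 2 * (‖e‖ + (3 * ‖h‖ * coefB w ρ₁ 3 * (max ‖d‖ ‖e‖) ^ 2 / r + 2) * ‖d‖ + 1) ≤ δ₀)
    (hsmall1 : (8 * ‖h‖ * coefB w ρ₁ 4 * (max ‖d‖ ‖e‖) ^ 3)
        * (3 * ‖h‖ * coefB w ρ₁ 3 * (max ‖d‖ ‖e‖) ^ 2 / r + 1) ^ 2 ≤ r / 2)
    (hsmall2 : 4 * ((8 * ‖h‖ * coefB w ρ₁ 4 * (max ‖d‖ ‖e‖) ^ 3)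
          * (3 * ‖h‖ * coefB w ρ₁ 3 * (max ‖d‖ ‖e‖) ^ 2 / r + 1) ^ 3
        + (8 * ‖h‖ * coefB w ρ₁ 4 * (max ‖d‖ ‖e‖) ^ 3) ^ 2
          * (3 * ‖h‖ * coefB w ρ₁ 3 * (max ‖d‖ ‖e‖) ^ 2 / r + 1) ^ 4 / (2 * r))
      ≤ (‖h‖ * coefB w ((1 + τ) * ρ₂) 3) ^ 2 * (d * (starRingEnd ℂ) e).im ^ 2
          / (3 * ‖h‖ * coefB w ρ₁ 3 * ‖d‖ ^ 2)) :
    TransverseHyp (trap u ρ₁ ρ₂ τ) d e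
      (fun z => (shiftPhase w u h z).im) (fun z => (shiftPhase₁ w h z * d).im) (fun z => (shiftPhase₁ w h z * e).im)
      (fun z => (shiftPhase₂ w h z * d ^ 2).im) (fun z => (shiftPhase₂ w h z * d * e).im)
      (fun z => (shiftPhase₂ w h z * e ^ 2).im)
      φ r (3 * ‖h‖ * coefB w ρ₁ 3 * ‖d‖ ^ 2 / r) (3 * ‖h‖ * coefB w ρ₁ 3 * (max ‖d‖ ‖e‖) ^ 2)
      (8 * ‖h‖ * coefB w ρ₁ 4 * (max ‖d‖ ‖e‖) ^ 3)
      ((‖h‖ * coefB w ((1 + τ) * ρ₂) 3) ^ 2 * (d * (starRingEnd ℂ) e).im ^ 2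
          / (3 * ‖h‖ * coefB w ρ₁ 3 * ‖d‖ ^ 2))
      ((3 * ‖h‖ * coefB w ρ₁ 3) ^ 2 * (d * (starRingEnd ℂ) e).im ^ 2 / r)
      (8 * ‖h‖ * coefB w ρ₁ 4 * ‖d‖ ^ 2) G Lφ δ₀ := by
  have hρ₂ : 0 < ρ₂ := hρ₁.trans_le hρ₁₂
  have hρ₂' : 0 < (1 + τ) * ρ₂ := by positivity
  have hhn : 0 < ‖h‖ := norm_pos_iff.2 hh0
  have hh1 : ‖h‖ < ρ₁ := lt_of_le_of_lt hh (by linarith)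
  have hB₂0 : 0 < 3 * ‖h‖ * coefB w ρ₁ 3 := by have := coefB_pos hw hρ₁ 3; positivity
  have hb₂0 : 0 < ‖h‖ * coefB w ((1 + τ) * ρ₂) 3 := by have := coefB_pos hw hρ₂' 3; positivity
  have hb₂B₂ : ‖h‖ * coefB w ((1 + τ) * ρ₂) 3 ≤ 3 * ‖h‖ * coefB w ρ₁ 3 := by
    have h1 : coefB w ((1 + τ) * ρ₂) 3 ≤ coefB w ρ₁ 3 := coefB_anti w hρ₁ (by nlinarith) 3
    have h2 : 0 ≤ coefB w ρ₁ 3 := coefB_nonneg w hρ₁ 3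
    nlinarith
  have hB₃0 : 0 ≤ 8 * ‖h‖ * coefB w ρ₁ 4 := by have := coefB_nonneg w hρ₁ 4; positivity
  exact transverseHyp_of_chain (shiftPhase_holChain w u h) hu hρ₁ hτ (trap_subset_shiftDom hu hρ₁ hh1) hd hde
    hB₂0 hb₂0 hb₂B₂ hB₃0
    (fun z hz => norm_shiftPhase₂_le hu hρ₁ hh hz) (fun z hz => norm_shiftPhase₂_ge hu hρ₁ hτ hh hz)
    (fun z hz => norm_shiftPhase₃_le hu hρ₁ hh hz)
    hr hG hLφ hdir hrB hφG lipφ hφ0 hδ₀ hsmall1 hsmall2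


end VdC
end Literature.NumberTheory.LFunctions

end
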